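import Literature.MathematicalPhysics.QuantumFieldTheory.Balaban1983to89.FlowStepRuns
import Literature.MathematicalPhysics.QuantumFieldTheory.Balaban1983to89.BetaDerivClause
import Literature.MathematicalPhysics.QuantumFieldTheory.Balaban1983to89.Beta.OneLoop
import Literature.MathematicalPhysics.QuantumFieldTheory.Balaban1983to89.Beta.LimitRate
import Literature.MathematicalPhysics.QuantumFieldTheory.Balaban1983to89.Beta.Drift
import Literature.MathematicalPhysics.QuantumFieldTheory.Balaban1983to89.Beta.Transfer

/-!
# `Balaban1983to89.Beta.Assembly` — TOP NODE of the β sub-cell (row BETA-an5): the RESIDUAL HYPOTHESES on the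
β-functions (1.22) of [Balaban1987RG1] in their honest LIMIT FORM, and the kernel theorems from exactly these to
every consumer the cell has located; "inf_k β⁰_{k+1} > 0" REDUCED to a finite certified list

CITATION HEADER (lean-in-tree rule 2026-08-18).  Source under audit: T. Bałaban, *Renormalization group approach to
lattice gauge field theories. I. Generation of effective actions in a small field approximation and a coupling
constant renormalization in four dimensions*, Commun. Math. Phys. **109**, 249–301 (1987), doi:10.1007/bf01215223
[Balaban1987RG1] (cell paper B12; held `paper:balaban1987-cmp109-rg-i-small-field`, journal page = PDF page + 248),
with *Large field renormalization. II*, Commun. Math. Phys. **122**, 355–392 (1989) [Balaban1989LargeFieldII] (B16)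
and *Convergent renormalization expansions …* Commun. Math. Phys. **119**, 243–285 (1988) [Balaban1988Convergent]
(B14).  Locators used: (1.3)/(1.6) pp. 260–261 and (2.12)–(2.14) p. 268 (the one-loop split, `B12Beta.OneLoopSplit`),
(1.22) p. 264 (β as a second moment), p. 264 "uniformly bounded on this interval" (the printed upper bound), Theorem 2
p. 259 with (0.31) (`B12.Thm2Printed`), (5.10) p. 293 and (5.42) p. 297 (the decay giving the upper bound,
`B12Sec2to5`), [Balaban1989LargeFieldII] p. 355 ("second order perturbative calculations … has not been published
yet").  No formula is newly quoted in this module: every printed input enters through the modules it imports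
(`FlowStep`, `FlowStepRuns`, `B12Beta`, `B12Sec2to5`, `BetaDerivClause`, `Beta.OneLoop`, `Beta.LimitRate`,
`Beta.Drift`, `Beta.Transfer`, `B12Normalization`), whose citation headers carry the verbatim quotations.

HONEST FRAMING (cell rule, verbatim, page 1 of everything): discharging BetaPertH makes Bałaban's UV stability
UNCONDITIONAL — a real constructive-QFT result; it is NOT the continuum limit and NOT the Clay problem.

ABSOLUTE RULE (cell rule, verbatim): "No internally-minted statement may enter as a cited fact. Every hypothesis is
either kernel-proved in this package or a verbatim quotation of a PUBLISHED theorem with page reference. The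
manuscript(s) under audit are NOT citable for their own disputed steps — they are the thing under adjudication;
programme-internal (2001/route/tribunal) claims are never citable."  In particular [Balaban1987RG1] is NOT cited here
for any property of its β-functions beyond the formula (1.22) and the bound that (5.10) yields; no β-coefficient of
another scheme enters (it could only do so through a PROVED transfer statement, row an3).

WHAT THIS MODULE IS.  The β sub-cell (cell HOME/BETA-SPEC.md) set out to DISCHARGE the flow-side input of the cell's
DAG — first typed as `FlowStep.BetaPertH` ([Balaban1989LargeFieldII] p. 355), refined (BETA-SPEC §0.3/§0.3′, OBJECTS.md
§4, `FlowStepRuns` §10, `BetaPertRigid`) to the LIMIT FORM of the printed one-loop split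
`β_{k+1}(g_0,…,g_k) = β⁰_{k+1} + β¹_{k+1}(g_0,…,g_k)`:
  (AF-0∞)  `0 < β⁰_∞`                                  — rows an3 (transfer) / an2 (direct sign): OPEN;
  (AF-0r)  `|β⁰_{k+1} − β⁰_∞| ≤ c₀θ^k`, `0 ≤ θ < 1`      — rows an1 / an2 (η = L^{−k} → 0 with a rate): OPEN, unprinted
           (kernel reduction to a (5.10)-type rate on the polarization kernels: unit pv05-g3, `Beta.LimitRate`);
  (AF-1)   `|β¹_{k+1}(g_0,…,g_k)| ≤ C g_k` on ]0,γ₀]-histories — row an4: OPEN, located at [B13] (1.18-∂)/(P1)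
           (`BetaDerivClause`: ⇐ `LastVarLipschitzAtZero`);
  (C)      joint continuity on the boxes                — row an4: OPEN (⇐ `CoordLipschitzAt` at every scale);
  (U)      `β_{k+1} ≤ β′` on the boxes                   — PRINTED (p. 264; ⇐ (5.10)+(5.42), `FlowStepRuns` §5);
  (AF-0s)  the FINITE list `3β⁰_∞/4 ≤ β⁰_{k+1}, k < k₀`   — row num (certified numerics): OPEN; consumed ONLY by the
           literal lower half of (0.31) for all k (`thm2Printed`), by nothing else the cell has located.
This module packages (AF-0∞)+(AF-0r)+(AF-1)+(C)+(U) as ONE hypothesis carrier `LimitForm β` (a structure of DATA and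
HYPOTHESES over the existing carriers — no new `Prop` fact, D-0026) and proves (kernel-checked, no placeholders) from it alone:
  * (A-ps) `FlowStepRuns.BetaPartialSumsLowerH (c₀/(1−θ)) γ β` for `γ ≤ γ₀`, `Cγ ≤ β⁰_∞` (`LimitForm.partialSums`) and
    an1's drift form `|Σ_{j<k} β⁰_{j+1} − kβ⁰_∞| ≤ c₀/(1−θ)` (`sum_beta0_drift`);
  * an EXPLICIT box size `γ₁ = min γ₀ (β⁰_∞/(4(C+1)))` and the LEAST scale `k₀` with `c₀θ^{k₀} ≤ β⁰_∞/4`, with the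
    closed-form sufficient condition `log(4c₀/β⁰_∞) ≤ n log θ⁻¹ ⇒ k₀ ≤ n` for the numerics row (`k₀_le_of_log`);
  * `β_{k+1} ≥ β⁰_∞/2` on ]0,γ₁]-boxes for `k ≥ k₀` (`tail_lower`), `β_{k+1} ≥ −c₀θ^k` for all k (`lower_geometric`),
    hence `0 < β′` (`β'_pos`);
  * THE ROW'S "inf_k β⁰_{k+1} > 0": `3β⁰_∞/4 ≤ β⁰_{k+1}` for every `k ≥ k₀` (`beta0_ge_of_le`), so positivity /
    a uniform positive lower bound of ALL one-loop coefficients is EQUIVALENT, given the limit form, to the finite list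
    of signs `0 < β⁰_{k+1}, k < k₀` (`beta0_pos_all`, `exists_uniform_beta0_lower`) — the honest residual of this row;
  * every located [I]/[II.16]-side consumer: `DagBinding.EndpointExistence C` for forward-generated constructions
    (`LimitForm.endpointExistence`, NO small-k signs), the [Balaban1989LargeFieldII] p. 355 unconditional reading
    `B16.Sect2Unconditional ∧ (0.1)` (`LimitForm.p355`, NO small-k signs; smallness of the world's γ explicit), and
    Theorem 2 AS PRINTED `B12.Thm2Printed C L` from the limit form PLUS (AF-0s) (`LimitForm.thm2Printed`,
    `thm2Printed_of_list`);
  * the constructors from the rows' typed outputs (`LimitForm.ofClauses`: (AF-1),(C) from row an4's clauses via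
    `BetaDerivClause.af1_of_atZero` / `betaContH_of_coordLipschitz`; `upper_of_decay510`: (U) from (5.10)+(5.42)) and a
    NON-VACUITY witness (`Witness.limitFormOne`: the hypotheses are jointly satisfiable, `k₀ = 0`).
  * the [III]-side consumers along in-interval runs — (2.6)–(2.9) with the printed constants AND (2.46)
    (`LimitForm.flowControl_along`, `LimitForm.p355_and_sum246`, through unit strat-b14's history→run bridge
    `FlowStepRuns` §11 and `B14FlowStep` §J; NO small-k signs);
  * the same hypotheses read in the sibling forms of rows an1 / an3 (`LimitForm.drift : Beta.Drift.OneLoopDrift …`,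
    `LimitForm.marginalBounded : Beta.Transfer.MarginalBounded …`);
  * §2 the MINIMAL residual form `EventualForm β` = (EV-AF) an eventual positive lower bound on the boxes + the PRINTED
    two-sided bound + (C) (`FlowStepRuns` §11, second half), with every consumer except the literal (0.31) on coarse
    lattices (`EventualForm.endpointExistence`, `.p355_and_sum246`, `.thm2_fineLattices`, `.thm2Printed_of_list`),
    and `LimitForm.toEventual` (the limit form is ONE route to it); §2′ the (MB) slot `BoundedForm β` = bounded
    oscillation of `Σ_{j<k} β⁰_{j+1}` about `k·B`, `B > 0` (rows an1/an3; lead's ruling BETA-SPEC v1.5 §6.1) + (AF-1) +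
    (C) + (U), with its [I]-side consumers (`BoundedForm.endpointExistence`, `.p355`, by `Beta.Transfer`) and
    `LimitForm.toBounded`;
  * §3 the kernel-level production of the limit form from row BETA-0's dictionary and unit pv05-g3's
    `Beta.LimitRate.KernelInputs` (`LimitForm.ofKernelInputs`; the transfer road to the sign `LimitForm.ofTransfer`,
    `β⁰_∞ = (11N²/12π²) log L` then by `Beta.LimitRate.binf_eq_stepBal_of_transfer` — from the HYPOTHESIS `TransferBal`,
    never as a fact);
  * §4 THE TYPED WALL: the chain with every hypothesis named by owner, straight to the consumers
    (`endpointExistence_of_wall`, `thm2Printed_of_wall`, `thm2Printed_of_wall_transfer`);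
  * §6 (v1.1, append-only) the (AF-1w) slot: `EventualForm.ofSplitOneSided` / `ofConvConst` — a ONE-SIDED CONSTANT
    remainder bound `−r ≤ β¹_{k+1}`, `r ≤ 3β⁰_∞/8`, replaces the k-uniform Lipschitz constant of (AF-1) for the END
    statement (row an4's weakened slot; `endpointExistence_of_convConst`).

REVISION v1.2 (unit `b2b-balaban-beta-an5` gen 2, DOCFIX G-beta-10r of REFEREE-BETA R28/R38/R46(b)): docstring of
`LimitForm.ofTransfer` only — the value `(11N²/12π²) log L` is cited to the tree constant `B12Normalization.stepBal` /
[MontvayMunster1994, (5.66)] instead of B12 (0.18), which prints only the recursion; NO declaration, statement or proof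
changed (v1.1 = p177745, v1 = p177680).  The explicit `EventualForm.ofTransfer` of R31 lives in the sibling module
`Beta.TransferEventual` (unit pv14-g2, p178023), not here.

WHAT THIS MODULE IS NOT.  It asserts NOTHING about Bałaban's β-functions: every theorem is an implication from the
fields of `LimitForm`.  It does NOT discharge the literal `FlowStep.BetaPertH β β̄` (a single k-independent β̄ with an
O(γ²) remainder), which is rigid (`BetaPertRigid`: it forces `β⁰_{k+1} = β̄` for all k) and presumably false for (1.22)
since `β⁰_{k+1}` depends on k through η = L^{−k} (cell DIVERGENCE D-b12-3); the limit form is its honest successor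
(BETA-SPEC §0.3).  For Bałaban's family the fields (AF-0∞), (AF-0r), (AF-1), (C) are OPEN (rows an1–an4, GAPS
G-an1-*, G-an2-*, G-b12-1/2) and (AF-0s) awaits c₀, θ, β⁰_∞ (row num); the census by tree name is the prose companion
`run/shared/lean/pub/pub-balaban/BETA/ASSEMBLY.md`.  UNITS (OBJECTS.md §3, `B12Normalization`): all coefficients are in
Bałaban's normalisation (action `g⁻²(1 − Re tr U_p)`, normalised trace); the expected value of β⁰_∞ there,
`(11N²/12π²) log L` (`B12Normalization.stepBal`), enters only as the limit NAMED in the hypothesis `TransferBal` (§3–§4).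
Value = kernel-checked assembly + the precise residual hypotheses, NOT summit progress (audit cell `pub-balaban`,
β sub-cell row BETA-an5, unit `b2b-balaban-beta-an5`; co-owned kernel `Beta.LimitRate` by unit `b2b-balaban-pv05-g3`).
-/

namespace Literature.MathematicalPhysics.QuantumFieldTheory.Balaban1983to89.Beta.Assembly

open Literature.MathematicalPhysics.QuantumFieldTheory.Balaban1983to89
open Literature.MathematicalPhysics.QuantumFieldTheory.Balaban1983to89.FlowStep
open Literature.MathematicalPhysics.QuantumFieldTheory.Balaban1983to89.DagBinding
open Literature.MathematicalPhysics.QuantumFieldTheory.Balaban1983to89.FlowStepRuns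

noncomputable section

/-! ## 1. The residual hypotheses in the limit form -/

/-- **The residual flow-side hypotheses of the cell's DAG in the LIMIT FORM** (BETA-SPEC §0.3′; `FlowStepRuns` §10),
for ONE history-dependent family `β : FlowStep.HBeta` (`β k (g_0,…,g_k) = β_{k+1}(g_0,…,g_k)`): the printed one-loop
split `S` ((1.3)/(1.6), (2.12)–(2.14)); a box size `γ₀ > 0`; the limit coefficient `binf = β⁰_∞ > 0` (AF-0∞); the
geometric rate `|β⁰_{k+1} − β⁰_∞| ≤ c₀θ^k`, `0 ≤ c₀`, `0 ≤ θ < 1` (AF-0r); the remainder bound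
`|β¹_{k+1}(p)| ≤ Cr·p_k` on ]0,γ₀]-histories (AF-1); joint continuity on the boxes (C); the upper bound `β ≤ β′` on the
boxes (U, PRINTED p. 264).  A carrier of DATA and HYPOTHESES: nothing is asserted to hold for (1.22); for Bałaban's
family every field except `upper` is a located UNPRINTED input (rows an1–an4 of the β sub-cell).
[cite: Balaban1987RG1, (2.12)–(2.14) p.268 and §1 p.264] -/
structure LimitForm (β : HBeta) where
  /-- the printed one-loop split `β_{k+1} = β⁰_{k+1} + β¹_{k+1}`, `β¹_{k+1}|_{g_k=0} = 0` ((2.12)–(2.14) p. 268). -/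
  S : B12Beta.OneLoopSplit β
  /-- box size of the hypotheses. -/
  γ₀ : ℝ
  γ₀_pos : 0 < γ₀
  /-- (AF-0∞) the limit one-loop coefficient `β⁰_∞` — OPEN for (1.22) (rows an3 transfer / an2 direct). -/
  binf : ℝ
  binf_pos : 0 < binf
  /-- (AF-0r) rate constants — OPEN for (1.22) (rows an1 / an2; kernel reduction `Beta.LimitRate`, unit pv05-g3). -/
  c₀ : ℝ
  c₀_nonneg : 0 ≤ c₀
  θ : ℝ
  θ_nonneg : 0 ≤ θ
  θ_lt_one : θ < 1
  conv : ∀ k, |S.β0 k - binf| ≤ c₀ * θ ^ k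
  /-- (AF-1) remainder constant and bound on ]0,γ₀]-histories — OPEN for (1.22), located at [B13] (P1) (row an4). -/
  Cr : ℝ
  Cr_nonneg : 0 ≤ Cr
  af1 : ∀ k (p : Fin (k + 1) → ℝ), p ∈ B12Beta.HistBox γ₀ k → |S.β1 k p| ≤ Cr * p (Fin.last k)
  /-- (C) joint continuity on the boxes — OPEN for (1.22) (row an4). -/
  cont : BetaContH γ₀ β
  /-- (U) the PRINTED upper bound (p. 264; from (5.10)+(5.42) by `upper_of_decay510`). -/
  β' : ℝ
  upper : BetaUpperH β' γ₀ β

namespace LimitForm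

variable {β : HBeta} (D : LimitForm β)

/-! ### 1.1 Restrictions to smaller boxes, the constants `M`, `γ₁`, `k₀` -/

/-- Boxes are monotone in the size. [folklore] -/
theorem box_mono {γ γ' : ℝ} (h : γ ≤ γ') {k : ℕ} {v : Fin (k + 1) → ℝ} (hv : v ∈ Box γ k) : v ∈ Box γ' k :=
  mem_box.mpr fun i => ⟨(mem_box.mp hv i).1, (mem_box.mp hv i).2.trans h⟩

/-- (AF-1) on smaller boxes. [folklore] -/
theorem af1_mono {γ : ℝ} (hγ : γ ≤ D.γ₀) :
    ∀ k (p : Fin (k + 1) → ℝ), p ∈ B12Beta.HistBox γ k → |D.S.β1 k p| ≤ D.Cr * p (Fin.last k) :=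
  fun k p hp => D.af1 k p fun i => ⟨(hp i).1, (hp i).2.trans hγ⟩

/-- (C) on smaller boxes. [folklore] -/
theorem cont_mono {γ : ℝ} (hγ : γ ≤ D.γ₀) : BetaContH γ β :=
  fun k => (D.cont k).mono fun _ hv => box_mono hγ hv

/-- (U) on smaller boxes. [folklore] -/
theorem upper_mono {γ : ℝ} (hγ : γ ≤ D.γ₀) : BetaUpperH D.β' γ β :=
  fun k v hv => D.upper k v (box_mono hγ hv)

/-- `0 < 1 − θ`. [folklore] -/
theorem one_sub_θ_pos : 0 < 1 - D.θ := by linarith [D.θ_lt_one]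

/-- The partial-sum constant `M = c₀/(1−θ)` of (A-ps). [folklore] -/
def M : ℝ := D.c₀ / (1 - D.θ)

/-- `0 ≤ M`. [folklore] -/
theorem M_nonneg : 0 ≤ D.M := div_nonneg D.c₀_nonneg D.one_sub_θ_pos.le

/-- The EXPLICIT box size on which positivity holds from `k₀` on: `γ₁ = min γ₀ (β⁰_∞ / (4(C+1)))`. [folklore] -/
def γ₁ : ℝ := min D.γ₀ (D.binf / (4 * (D.Cr + 1)))

/-- `0 < γ₁`. [folklore] -/
theorem γ₁_pos : 0 < D.γ₁ := by
  have := D.Cr_nonneg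
  have := D.binf_pos
  exact lt_min D.γ₀_pos (by positivity)

/-- `γ₁ ≤ γ₀`. [folklore] -/
theorem γ₁_le : D.γ₁ ≤ D.γ₀ := min_le_left _ _

/-- `C γ₁ ≤ β⁰_∞/4`. [folklore] -/
theorem Cr_mul_γ₁_le : D.Cr * D.γ₁ ≤ D.binf / 4 := by
  have hCr := D.Cr_nonneg
  have hb := D.binf_pos
  have h1 : D.γ₁ ≤ D.binf / (4 * (D.Cr + 1)) := min_le_right _ _
  have h2 : D.Cr * (D.binf / (4 * (D.Cr + 1))) ≤ D.binf / 4 := by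
    rw [mul_div_assoc', div_le_div_iff₀ (by positivity) (by positivity)]
    nlinarith
  exact (mul_le_mul_of_nonneg_left h1 hCr).trans h2

/-- `C γ₁ ≤ β⁰_∞`. [folklore] -/
theorem Cr_mul_γ₁_le_binf : D.Cr * D.γ₁ ≤ D.binf := D.Cr_mul_γ₁_le.trans (by linarith [D.binf_pos])

/-- Some scale `k₀` has `c₀θ^{k₀} ≤ β⁰_∞/4` (`c₀θ^k → 0`). [folklore] -/
theorem exists_k₀ : ∃ k₀ : ℕ, D.c₀ * D.θ ^ k₀ ≤ D.binf / 4 :=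
  exists_k0_of_geometric D.θ_lt_one (by linarith [D.binf_pos])

open Classical in
/-- THE LEAST scale `k₀` with `c₀θ^{k₀} ≤ β⁰_∞/4` — the length of the finite list (AF-0s). [folklore] -/
def k₀ : ℕ := Nat.find D.exists_k₀

open Classical in
/-- `c₀θ^{k₀} ≤ β⁰_∞/4`. [folklore] -/
theorem k₀_spec : D.c₀ * D.θ ^ D.k₀ ≤ D.binf / 4 := Nat.find_spec D.exists_k₀

open Classical in
/-- Minimality: any `n` with `c₀θ^n ≤ β⁰_∞/4` bounds `k₀`. [folklore] -/
theorem k₀_le {n : ℕ} (h : D.c₀ * D.θ ^ n ≤ D.binf / 4) : D.k₀ ≤ n := Nat.find_min' D.exists_k₀ h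

/-- `c₀θ^k ≤ β⁰_∞/4` for every `k ≥ k₀`. [folklore] -/
theorem geometric_le_of_k₀_le {k : ℕ} (hk : D.k₀ ≤ k) : D.c₀ * D.θ ^ k ≤ D.binf / 4 :=
  (mul_le_mul_of_nonneg_left (pow_le_pow_of_le_one D.θ_nonneg D.θ_lt_one.le hk) D.c₀_nonneg).trans D.k₀_spec

/-- Closed form for the numerics row: for `0 < c`, `0 < θ`, `0 < b`, if `log(c/b) ≤ n·log θ⁻¹` then `cθ^n ≤ b`.
[folklore] -/
theorem geometric_le_of_log {c θ b : ℝ} (hc : 0 < c) (hθ : 0 < θ) (hb : 0 < b) {n : ℕ}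
    (hn : Real.log (c / b) ≤ n * Real.log θ⁻¹) : c * θ ^ n ≤ b := by
  have hθn : 0 < θ ^ n := pow_pos hθ n
  have h3 : Real.log (θ ^ n) ≤ Real.log (b / c) := by
    rw [Real.log_pow, Real.log_div hb.ne' hc.ne']
    rw [Real.log_inv, Real.log_div hc.ne' hb.ne'] at hn
    linarith
  have h4 : θ ^ n ≤ b / c := (Real.log_le_log_iff hθn (div_pos hb hc)).mp h3
  calc c * θ ^ n ≤ c * (b / c) := mul_le_mul_of_nonneg_left h4 hc.le
    _ = b := by field_simp

/-- EXPLICIT `k₀` for the numerics row: if `0 < c₀`, `0 < θ` and `log(4c₀/β⁰_∞) ≤ n log θ⁻¹` then `k₀ ≤ n`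
(for `c₀ = 0`, `k₀ = 0` by `k₀_le`). [folklore] -/
theorem k₀_le_of_log (hc : 0 < D.c₀) (hθ : 0 < D.θ) {n : ℕ}
    (hn : Real.log (4 * D.c₀ / D.binf) ≤ n * Real.log D.θ⁻¹) : D.k₀ ≤ n := by
  refine D.k₀_le (geometric_le_of_log hc hθ (by linarith [D.binf_pos]) ?_)
  have : D.c₀ / (D.binf / 4) = 4 * D.c₀ / D.binf := by rw [div_div_eq_mul_div]; ring
  rwa [this]

/-- For `c₀ = 0` (constant one-loop coefficients) the list is empty: `k₀ = 0`. [folklore] -/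
theorem k₀_eq_zero (hc : D.c₀ = 0) : D.k₀ = 0 :=
  Nat.le_zero.mp (D.k₀_le (n := 0) (by rw [hc, zero_mul]; linarith [D.binf_pos]))

/-! ### 1.2 The row's item "inf_k β⁰_{k+1} > 0": reduced to the finite list (AF-0s) -/

/-- **Tail of the one-loop coefficients**: `3β⁰_∞/4 ≤ β⁰_{k+1}` for every `k ≥ k₀`. [folklore] -/
theorem beta0_ge_of_le (k : ℕ) (hk : D.k₀ ≤ k) : 3 * D.binf / 4 ≤ D.S.β0 k := by
  have h1 := abs_le.mp (D.conv k)
  linarith [D.geometric_le_of_k₀_le hk, h1.1]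

/-- Two-sided: `|β⁰_{k+1} − β⁰_∞| ≤ β⁰_∞/4` for `k ≥ k₀`. [folklore] -/
theorem beta0_near_of_le (k : ℕ) (hk : D.k₀ ≤ k) : |D.S.β0 k - D.binf| ≤ D.binf / 4 :=
  (D.conv k).trans (D.geometric_le_of_k₀_le hk)

/-- Positivity on the tail: `0 < β⁰_{k+1}` for `k ≥ k₀`. [folklore] -/
theorem beta0_pos_of_le (k : ℕ) (hk : D.k₀ ≤ k) : 0 < D.S.β0 k := by
  linarith [D.beta0_ge_of_le k hk, D.binf_pos]

/-- **"inf_k β⁰_{k+1} > 0" ⇔ the finite list**: given the limit form, positivity of ALL one-loop coefficients is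
exactly the finitely many signs `0 < β⁰_{k+1}, k < k₀` (row num: certified numerics). [folklore] -/
theorem beta0_pos_all (hsmall : ∀ k, k < D.k₀ → 0 < D.S.β0 k) : ∀ k, 0 < D.S.β0 k :=
  fun k => (lt_or_ge k D.k₀).elim (hsmall k) (D.beta0_pos_of_le k)

/-- The (AF-0s) list in the strength the literal (0.31) consumes: `3β⁰_∞/4 ≤ β⁰_{k+1}` for ALL k from the same for
`k < k₀`. [folklore] -/
theorem beta0_lower_all (hsmall : ∀ k, k < D.k₀ → 3 * D.binf / 4 ≤ D.S.β0 k) : ∀ k, 3 * D.binf / 4 ≤ D.S.β0 k :=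
  fun k => (lt_or_ge k D.k₀).elim (hsmall k) (D.beta0_ge_of_le k)

/-- **A uniform positive lower bound of all one-loop coefficients** from the finite list of SIGNS alone:
`∃ b > 0, ∀ k, b ≤ β⁰_{k+1}` (`b` = the least of `3β⁰_∞/4` and the finitely many early coefficients). [folklore] -/
theorem exists_uniform_beta0_lower (hsmall : ∀ k, k < D.k₀ → 0 < D.S.β0 k) :
    ∃ b : ℝ, 0 < b ∧ ∀ k, b ≤ D.S.β0 k := by
  classical
  set T : Finset ℝ := insert (3 * D.binf / 4) ((Finset.range D.k₀).image D.S.β0) with hT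
  have hne : T.Nonempty := Finset.insert_nonempty _ _
  refine ⟨T.min' hne, ?_, fun k => ?_⟩
  · have hmem := T.min'_mem hne
    rcases Finset.mem_insert.mp hmem with h | h
    · rw [h]; linarith [D.binf_pos]
    · obtain ⟨k, hk, hkq⟩ := Finset.mem_image.mp h
      rw [← hkq]; exact hsmall k (Finset.mem_range.mp hk)
  · rcases lt_or_ge k D.k₀ with hk | hk
    · exact T.min'_le _ (Finset.mem_insert_of_mem (Finset.mem_image.mpr ⟨k, Finset.mem_range.mpr hk, rfl⟩))
    · exact (T.min'_le _ (Finset.mem_insert_self _ _)).trans (D.beta0_ge_of_le k hk)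

/-- **The drift form follows** (row an1's (T-drift), `Beta.Drift`): `|Σ_{j<k} β⁰_{j+1} − k·β⁰_∞| ≤ c₀/(1−θ)` for
every k. [folklore] -/
theorem sum_beta0_drift (k : ℕ) : |∑ j ∈ Finset.range k, D.S.β0 j - k * D.binf| ≤ D.M := by
  have h : ∑ j ∈ Finset.range k, D.S.β0 j - k * D.binf = ∑ j ∈ Finset.range k, (D.S.β0 j - D.binf) := by
    rw [Finset.sum_sub_distrib, Finset.sum_const, Finset.card_range, nsmul_eq_mul]
  rw [h]
  have hgeom : ∑ j ∈ Finset.range k, D.θ ^ j ≤ 1 / (1 - D.θ) := by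
    have h := geom_sum_Ico_le_of_lt_one D.θ_nonneg D.θ_lt_one (m := 0) (n := k)
    rw [pow_zero] at h
    rwa [Finset.range_eq_Ico]
  calc |∑ j ∈ Finset.range k, (D.S.β0 j - D.binf)|
      ≤ ∑ j ∈ Finset.range k, |D.S.β0 j - D.binf| := Finset.abs_sum_le_sum_abs _ _
    _ ≤ ∑ j ∈ Finset.range k, D.c₀ * D.θ ^ j := Finset.sum_le_sum fun j _ => D.conv j
    _ = D.c₀ * ∑ j ∈ Finset.range k, D.θ ^ j := by rw [Finset.mul_sum]
    _ ≤ D.c₀ * (1 / (1 - D.θ)) := mul_le_mul_of_nonneg_left hgeom D.c₀_nonneg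
    _ = D.M := mul_one_div D.c₀ (1 - D.θ)

/-! ### 1.3 Consequences for the β-functions on boxes -/

/-- (A-ps): partial sums of the β's along ]0,γ]-histories are `≥ −c₀/(1−θ)`, for `γ ≤ γ₀` with `Cγ ≤ β⁰_∞` — NO
small-k signs (`FlowStepRuns.betaPartialSumsLowerH_of_limitSplit`). [folklore] -/
theorem partialSums {γ : ℝ} (hγ₀ : γ ≤ D.γ₀) (hγ : D.Cr * γ ≤ D.binf) : BetaPartialSumsLowerH D.M γ β :=
  betaPartialSumsLowerH_of_limitSplit D.S D.θ_nonneg D.θ_lt_one D.c₀_nonneg D.conv (D.af1_mono hγ₀) D.Cr_nonneg hγ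

/-- (A-ps) on the explicit box ]0,γ₁]. [folklore] -/
theorem partialSums_γ₁ : BetaPartialSumsLowerH D.M D.γ₁ β := D.partialSums D.γ₁_le D.Cr_mul_γ₁_le_binf

/-- `β_{k+1} ≥ −c₀θ^k` on ]0,γ]-boxes for all k (`γ ≤ γ₀`, `Cγ ≤ β⁰_∞`). [folklore] -/
theorem lower_geometric {γ : ℝ} (hγ₀ : γ ≤ D.γ₀) (hγ : D.Cr * γ ≤ D.binf) :
    ∀ k v, v ∈ Box γ k → -(D.c₀ * D.θ ^ k) ≤ β k v :=
  fun k v hv => beta_ge_neg_geometric_of_limitSplit D.S D.conv (D.af1_mono hγ₀) D.Cr_nonneg hγ k v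
    (histBox_of_mem_box hv)

/-- **Positivity on the tail**: `β_{k+1} ≥ β⁰_∞/2` on ]0,γ₁]-boxes for every `k ≥ k₀`. [folklore] -/
theorem tail_lower : ∀ k, D.k₀ ≤ k → ∀ v ∈ Box D.γ₁ k, D.binf / 2 ≤ β k v :=
  betaLower_tail_of_limitSplit D.S D.θ_nonneg D.θ_lt_one.le D.c₀_nonneg D.conv (D.af1_mono D.γ₁_le) D.Cr_nonneg
    D.k₀_spec D.Cr_mul_γ₁_le

/-- The printed upper constant is positive (the boxes are non-empty and `β ≥ β⁰_∞/2 > 0` on the tail). [folklore] -/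
theorem β'_pos : 0 < D.β' := by
  have hmem : (fun _ : Fin (D.k₀ + 1) => D.γ₁) ∈ Box D.γ₁ D.k₀ := mem_box.mpr fun _ => ⟨D.γ₁_pos, le_rfl⟩
  have h1 := D.tail_lower D.k₀ le_rfl _ hmem
  have h2 := D.upper_mono D.γ₁_le D.k₀ _ hmem
  linarith [D.binf_pos]

/-- `β⁰_∞/2 ≤ β′`. [folklore] -/
theorem half_binf_le_β' : D.binf / 2 ≤ D.β' := by
  have hmem : (fun _ : Fin (D.k₀ + 1) => D.γ₁) ∈ Box D.γ₁ D.k₀ := mem_box.mpr fun _ => ⟨D.γ₁_pos, le_rfl⟩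
  exact (D.tail_lower D.k₀ le_rfl _ hmem).trans (D.upper_mono D.γ₁_le D.k₀ _ hmem)

/-- **(AF-0) for all k from a finite list** (any length `k₁` past the threshold): `c₀θ^{k₁} ≤ β⁰_∞/4` and
`3β⁰_∞/4 ≤ β⁰_{k+1}` for `k < k₁` give `FlowStep.BetaLowerH (β⁰_∞/2) γ₁ β`. [folklore] -/
theorem betaLowerH_of_list {k₁ : ℕ} (hk₁ : D.c₀ * D.θ ^ k₁ ≤ D.binf / 4)
    (hsmall : ∀ k, k < k₁ → 3 * D.binf / 4 ≤ D.S.β0 k) : BetaLowerH (D.binf / 2) D.γ₁ β :=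
  betaLowerH_of_limitSplit D.S D.θ_nonneg D.θ_lt_one.le D.c₀_nonneg D.conv (D.af1_mono D.γ₁_le) D.Cr_nonneg hk₁
    D.Cr_mul_γ₁_le hsmall

/-- (AF-0) for all k from the MINIMAL list `k < k₀`. [folklore] -/
theorem betaLowerH_of_smallList (hsmall : ∀ k, k < D.k₀ → 3 * D.binf / 4 ≤ D.S.β0 k) :
    BetaLowerH (D.binf / 2) D.γ₁ β :=
  D.betaLowerH_of_list D.k₀_spec hsmall

/-- Discrete asymptotic freedom `FlowStep.BetaAFH β` from the limit form + the finite list. [folklore] -/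
theorem betaAFH_of_smallList (hsmall : ∀ k, k < D.k₀ → 3 * D.binf / 4 ≤ D.S.β0 k) : BetaAFH β :=
  ⟨D.γ₁, D.γ₁_pos, D.binf / 2, by linarith [D.binf_pos], D.betaLowerH_of_smallList hsmall⟩

/-! ### 1.4 The located consumers -/

/-- **Endpoint existence** (`DagBinding.EndpointExistence C`: for every renormalised `0 < g ≤ g⋆` and every K a bare
coupling whose run ends at `g_K = g` inside the interval) for constructions generated forward by (0.20) from `β` —
from the limit form ALONE: NO small-k signs, NO (AF-0s). [cite: Balaban1987RG1, Thm 2 p.259 (first sentence)] -/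
theorem endpointExistence (D : LimitForm β) {C : B12.Construction} (hgen : ForwardGenerated C β) :
    EndpointExistence C :=
  endpointExistence_of_limitSplit hgen D.S D.γ₁_pos D.θ_nonneg D.θ_lt_one D.c₀_nonneg D.conv (D.af1_mono D.γ₁_le)
    D.Cr_nonneg D.Cr_mul_γ₁_le_binf D.β'_pos.le (D.cont_mono D.γ₁_le) (D.upper_mono D.γ₁_le)

/-- **The [Balaban1989LargeFieldII] p. 355 unconditional reading** — `B16.Sect2Unconditional w.C` and the ultraviolet
stability bound (0.1) with a bare coupling for every renormalised `g ≤ g⋆` — from the cell's `World` bookkeeping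
(`DagBinding.Nodes` for every run), the three modelling clauses, and the limit form, with the world's interval `γ`
small: `γ ≤ γ₀`, `Cγ ≤ β⁰_∞`, `β′ ≤ β⁺` (the world's upper constant) and `(c₀/(1−θ))γ² ≤ β₀(2+β₀)`.  NO small-k signs.
[cite: Balaban1989LargeFieldII, Thm 1 + (0.1) pp.355–356] -/
theorem p355 (w : World) (hγw : 0 < w.γ) (hγ₀ : w.γ ≤ D.γ₀) (hCrγ : D.Cr * w.γ ≤ D.binf) (hβup : D.β' ≤ w.βup)
    (hMγ : D.M * w.γ ^ 2 ≤ w.β₀ * (2 + w.β₀)) (hnodes : ∀ P, Nodes (leaves w P))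
    (hgen : ForwardGenerated w.C.toB12 β) (hhalt : HaltsOutside w.C.toB12 β) (hcur : CurriesHBeta w.C.toB12 β) :
    B16.Sect2Unconditional w.C ∧
      ∃ Em Ep : ℝ, ∀ m : ℕ, ∃ gstar : ℝ, 0 < gstar ∧ ∀ g : ℝ, 0 < g → g ≤ gstar →
        ∀ K : ℕ, ∃ g0 : ℝ, (w.C ⟨K, m, g0⟩).flow.g K = g ∧
          ∀ k, k ≤ K → ∀ V : (w.C ⟨K, m, g0⟩).Cfg k, B16.UVIneq (w.C ⟨K, m, g0⟩) k V Em Ep :=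
  p355Unconditional_of_limitSplit w hγw le_rfl (D.β'_pos.le.trans hβup) hnodes hgen hhalt hcur (D.cont_mono hγ₀)
    (fun k v hv => (D.upper_mono hγ₀ k v hv).trans hβup) D.S D.θ_nonneg D.θ_lt_one D.c₀_nonneg D.conv
    (D.af1_mono hγ₀) D.Cr_nonneg hCrγ hMγ

/-- **Theorem 2 AS PRINTED** (`B12.Thm2Printed C L`: bare couplings with (0.20) AND the two-sided (0.31) for ALL
`k ≤ K`) for forward-generated constructions, from the limit form PLUS a finite list (AF-0s) of any length `k₁` past
the threshold — the ONLY located consumer of the small-k signs. [cite: Balaban1987RG1, Thm 2 p.259 with (0.31)] -/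
theorem thm2Printed_of_list {C : B12.Construction} (hgen : ForwardGenerated C β) {L : ℝ} (hL : 1 < L) {k₁ : ℕ}
    (hk₁ : D.c₀ * D.θ ^ k₁ ≤ D.binf / 4) (hsmall : ∀ k, k < k₁ → 3 * D.binf / 4 ≤ D.S.β0 k) :
    B12.Thm2Printed C L :=
  thm2Printed_of_limitSplit hgen D.S hL D.γ₁_pos D.binf_pos D.θ_nonneg D.θ_lt_one.le D.c₀_nonneg D.conv
    (D.af1_mono D.γ₁_le) D.Cr_nonneg hk₁ D.Cr_mul_γ₁_le hsmall (D.upper_mono D.γ₁_le) (D.cont_mono D.γ₁_le)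

/-- Theorem 2 as printed from the limit form + the MINIMAL list (AF-0s) `3β⁰_∞/4 ≤ β⁰_{k+1}, k < k₀`.
[cite: Balaban1987RG1, Thm 2 p.259 with (0.31)] -/
theorem thm2Printed {C : B12.Construction} (hgen : ForwardGenerated C β) {L : ℝ} (hL : 1 < L)
    (hsmall : ∀ k, k < D.k₀ → 3 * D.binf / 4 ≤ D.S.β0 k) : B12.Thm2Printed C L :=
  D.thm2Printed_of_list hgen hL D.k₀_spec hsmall

/-- When the one-loop coefficients are CONSTANT in k (`c₀ = 0`: the literal `BetaPertH` regime), no list is needed.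
[cite: Balaban1987RG1, Thm 2 p.259 with (0.31)] -/
theorem thm2Printed_of_c₀_zero {C : B12.Construction} (hgen : ForwardGenerated C β) {L : ℝ} (hL : 1 < L)
    (hc : D.c₀ = 0) : B12.Thm2Printed C L :=
  D.thm2Printed hgen hL fun k hk => absurd hk (by rw [D.k₀_eq_zero hc]; exact Nat.not_lt_zero k)

/-! ### 1.5 The [III]-side consumers along runs (`FlowStepRuns` §11, unit strat-b14): (2.6)–(2.9) AND (2.46) -/

/-- **(2.6)–(2.9) with the printed constants AND (2.46) along every in-interval run** of a forward-generated
construction currying `β`, from the limit form ALONE (NO small-k signs), on the explicit box ]0,γ₁] and for a run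
interval `γ ≤ γ₁` with the γ-smallness of the defect `B = (β⁰_∞/2)k₀ + c₀/(1−θ)`; sizes `R_j` of (2.5) produced
(`FlowStepRuns.flowControl_along_of_limitSplit'`, `B14FlowStep.flowControl_of_limitLower`).
[cite: Balaban1988Convergent, (2.5)–(2.9) pp.255–256 and (2.46) p.263] -/
theorem flowControl_along {C : B12.Construction} (hgen : ForwardGenerated C β) (hhalt : HaltsOutside C β)
    (hcur : CurriesHBeta C β) {γ β₀ : ℝ} {L p : ℕ} (Sm : B14FlowStep.SmallnessFor γ D.β' β₀ L p) {A₀ : ℝ}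
    (hA₀ : 0 ≤ A₀) (hγ : γ ≤ D.γ₁)
    (hBγ : (D.binf / 2 * D.k₀ + D.c₀ / (1 - D.θ)) * γ ^ 2 ≤ β₀ * (2 + β₀))
    (hBγ' : (D.binf / 2 * D.k₀ + D.c₀ / (1 - D.θ)) * γ ^ 2 ≤ 1 / 2) {κ₀ : ℕ} (hκ : 6 ≤ κ₀)
    (hsmall : Real.sqrt 2 ^ (κ₀ - 6) * (2 * γ ^ 4 / (D.binf / 2) + γ ^ 6) < 1)
    (P : B12.RunParams) (hI : (C P).flow.InInterval γ P.K) :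
    ∃ R : ℕ → ℕ, (∀ j, B14.IsRj L p ((C P).flow.g j) (R j)) ∧
      (B14.FlowIneq26 (C P).flow.g D.β' β₀ P.K ∧ B14.FlowIneq27 (C P).flow.g D.β' β₀ p P.K ∧
        B14.FlowIneq28 (epsK A₀ p (C P).flow) (C P).flow.g D.β' β₀ P.K ∧
        B14FlowStep.FlowIneq29 R (C P).flow.g L D.β' β₀ P.K) ∧ B14FlowStep.SumIneq246 (C P).flow.g κ₀ P.K :=
  flowControl_along_of_limitSplit' hgen hhalt hcur D.S Sm hA₀ hγ D.θ_nonneg D.θ_lt_one D.c₀_nonneg D.binf_pos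
    D.conv (D.af1_mono D.γ₁_le) D.Cr_nonneg D.k₀_spec D.Cr_mul_γ₁_le (D.upper_mono D.γ₁_le) hBγ hBγ' hκ hsmall P hI

/-- **The cell's END statement WITH (2.46), from the limit form** (`FlowStepRuns.p355Unconditional_and_sum246_of_limitSplit`):
for a world whose interval `γ` is small — `γ ≤ γ₀`, `Cγ ≤ β⁰_∞/4`, `β′ ≤ β⁺`, `(c₀/(1−θ))γ² ≤ β₀(2+β₀)`,
`((β⁰_∞/2)k₀ + c₀/(1−θ))γ² ≤ 1/2`, `(√2)^{κ₀−6}(4γ⁴/β⁰_∞ + γ⁶) < 1` — the p. 355 unconditional reading AND (2.46)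
along every in-interval run; NO small-k signs. [cite: Balaban1989LargeFieldII, p.355; Balaban1988Convergent, (2.46) p.263] -/
theorem p355_and_sum246 (w : World) (hγw : 0 < w.γ) (hγ₀ : w.γ ≤ D.γ₀) (hCrγ : D.Cr * w.γ ≤ D.binf / 4)
    (hβup : D.β' ≤ w.βup) (hMγ : D.c₀ / (1 - D.θ) * w.γ ^ 2 ≤ w.β₀ * (2 + w.β₀))
    (hBγ' : (D.binf / 2 * D.k₀ + D.c₀ / (1 - D.θ)) * w.γ ^ 2 ≤ 1 / 2) {κ₀ : ℕ} (hκ : 6 ≤ κ₀)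
    (hsmall : Real.sqrt 2 ^ (κ₀ - 6) * (2 * w.γ ^ 4 / (D.binf / 2) + w.γ ^ 6) < 1)
    (hnodes : ∀ P, Nodes (leaves w P)) (hgen : ForwardGenerated w.C.toB12 β) (hhalt : HaltsOutside w.C.toB12 β)
    (hcur : CurriesHBeta w.C.toB12 β) :
    (B16.Sect2Unconditional w.C ∧
      ∃ Em Ep : ℝ, ∀ m : ℕ, ∃ gstar : ℝ, 0 < gstar ∧ ∀ g : ℝ, 0 < g → g ≤ gstar →
        ∀ K : ℕ, ∃ g0 : ℝ, (w.C ⟨K, m, g0⟩).flow.g K = g ∧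
          ∀ k, k ≤ K → ∀ V : (w.C ⟨K, m, g0⟩).Cfg k, B16.UVIneq (w.C ⟨K, m, g0⟩) k V Em Ep) ∧
    ∀ P : B12.RunParams, (w.C.toB12 P).flow.InInterval w.γ P.K →
      B14FlowStep.SumIneq246 (w.C.toB12 P).flow.g κ₀ P.K :=
  p355Unconditional_and_sum246_of_limitSplit w hγw le_rfl (D.β'_pos.le.trans hβup) hnodes hgen hhalt hcur
    (D.cont_mono hγ₀) (fun k v hv => (D.upper_mono hγ₀ k v hv).trans hβup) D.S D.θ_nonneg D.θ_lt_one D.c₀_nonneg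
    D.binf_pos D.conv (D.af1_mono hγ₀) D.Cr_nonneg D.k₀_spec hCrγ hMγ hBγ' hκ hsmall

/-! ### 1.6 The same hypotheses read in the two sibling forms of the sub-cell (rows an1 / an3) -/

/-- The limit form gives row an1's DRIFT form `Beta.Drift.OneLoopDrift β⁰_∞ (c₀/(1−θ)) β⁰` (`Beta.Drift.drift_of_geometric`).
[folklore] -/
theorem drift : Drift.OneLoopDrift D.binf D.M D.S.β0 :=
  Drift.drift_of_geometric D.θ_nonneg D.θ_lt_one D.c₀_nonneg D.conv

/-- … and row an3's bounded-remainder shape `Beta.Transfer.MarginalBounded β⁰ β⁰_∞ (c₀/(1−θ))`. [folklore] -/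
theorem marginalBounded : Transfer.MarginalBounded D.S.β0 D.binf D.M := fun k => D.sum_beta0_drift k

/-- `β_{k+1} ≥ −c₀` on ]0,γ]-boxes for all k (`γ ≤ γ₀`, `Cγ ≤ β⁰_∞`): a k-uniform lower bound. [folklore] -/
theorem lower_const {γ : ℝ} (hγ₀ : γ ≤ D.γ₀) (hγ : D.Cr * γ ≤ D.binf) : ∀ k v, v ∈ Box γ k → -D.c₀ ≤ β k v := by
  intro k v hv
  have h := D.lower_geometric hγ₀ hγ k v hv
  have hθk : D.c₀ * D.θ ^ k ≤ D.c₀ := mul_le_of_le_one_right D.c₀_nonneg (pow_le_one₀ D.θ_nonneg D.θ_lt_one.le)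
  linarith

end LimitForm

/-! ## 2. The MINIMAL residual form: an EVENTUAL positive lower bound + the printed two-sided bound + continuity

`FlowStepRuns` §11 (second half) shows that every located consumer of the flow except the literal lower half of (0.31)
on coarse lattices needs only: (EV-AF) `β_{k+1} ≥ b > 0` on the boxes from some scale `k₀` on; (TS) the PRINTED two-sided
bound `−β′ ≤ β_{k+1} ≤ β′` (p. 264; both halves from (5.10)+(5.42), `FlowStepRuns.betaBoundsH_of_decay510`); (C).  No
split, no rate.  The limit form is ONE ROUTE to (EV-AF) (`LimitForm.toEventual`: `b = β⁰_∞/2`, the explicit `k₀`, box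
]0,γ₁]); row an1's drift form and row an3's bounded remainder are routes to the weaker (A-ps) only. -/

/-- **The MINIMAL residual hypotheses**: box size `γ₀ > 0`; (EV-AF) `b > 0`, a scale `k₀` and `b ≤ β_{k+1}` on
]0,γ₀]^{k+1} for `k ≥ k₀` (OPEN for (1.22) — a located UNPRINTED input like every `β ≥ b` statement); (TS) the printed
two-sided bound with one constant `β′`; (C) joint continuity (OPEN, row an4).  Hypothesis carrier; nothing asserted.
[cite: Balaban1987RG1, §1 p.264] -/
structure EventualForm (β : HBeta) where
  γ₀ : ℝ
  γ₀_pos : 0 < γ₀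
  /-- (EV-AF): the eventual positive lower bound — OPEN for (1.22). -/
  b : ℝ
  b_pos : 0 < b
  k₀ : ℕ
  tail : ∀ k, k₀ ≤ k → ∀ v ∈ Box γ₀ k, b ≤ β k v
  /-- (TS): the PRINTED two-sided bound (p. 264 "uniformly bounded"; (5.10)+(5.42)). -/
  β' : ℝ
  upper : BetaUpperH β' γ₀ β
  lower : ∀ k, ∀ v ∈ Box γ₀ k, -β' ≤ β k v
  /-- (C): joint continuity on the boxes — OPEN for (1.22) (row an4). -/
  cont : BetaContH γ₀ β

namespace EventualForm

variable {β : HBeta} (E : EventualForm β)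

/-- `b ≤ β′` (evaluate at a box point of scale `k₀`). [folklore] -/
theorem b_le_β' : E.b ≤ E.β' := by
  have hmem : (fun _ : Fin (E.k₀ + 1) => E.γ₀) ∈ Box E.γ₀ E.k₀ := mem_box.mpr fun _ => ⟨E.γ₀_pos, le_rfl⟩
  exact (E.tail E.k₀ le_rfl _ hmem).trans (E.upper E.k₀ _ hmem)

/-- `0 < β′`. [folklore] -/
theorem β'_pos : 0 < E.β' := lt_of_lt_of_le E.b_pos E.b_le_β'

/-- (A-ps) with `M = β′k₀` (`FlowStepRuns.betaPartialSumsLowerH_of_eventualLower`). [folklore] -/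
theorem partialSums : BetaPartialSumsLowerH (E.β' * E.k₀) E.γ₀ β :=
  betaPartialSumsLowerH_of_eventualLower E.b_pos.le E.β'_pos.le E.tail E.lower

/-- **Endpoint existence from the minimal form** (forward-generated constructions); no split, no rate, no small-k
signs (`FlowStepRuns.endpointExistence_of_eventualLower`). [cite: Balaban1987RG1, Thm 2 p.259 (first sentence)] -/
theorem endpointExistence (E : EventualForm β) {C : B12.Construction} (hgen : ForwardGenerated C β) :
    EndpointExistence C :=
  endpointExistence_of_eventualLower hgen E.γ₀_pos E.b_pos.le E.β'_pos.le E.cont E.tail E.lower E.upper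

/-- **The p. 355 unconditional reading AND (2.46) along in-interval runs, from the minimal form**
(`FlowStepRuns.p355Unconditional_and_sum246_of_eventualLower`), the world's interval small: `γ ≤ γ₀`, `β′ ≤ β⁺`,
`β⁺k₀γ² ≤ β₀(2+β₀)`, `(b+β⁺)k₀γ² ≤ 1/2`, `(√2)^{κ₀−6}(2γ⁴/b + γ⁶) < 1`.
[cite: Balaban1989LargeFieldII, p.355; Balaban1988Convergent, (2.46) p.263] -/
theorem p355_and_sum246 (w : World) (hγw : 0 < w.γ) (hγ₀ : w.γ ≤ E.γ₀) (hβup : E.β' ≤ w.βup)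
    (hMγ : w.βup * E.k₀ * w.γ ^ 2 ≤ w.β₀ * (2 + w.β₀)) (hBγ' : (E.b + w.βup) * E.k₀ * w.γ ^ 2 ≤ 1 / 2)
    {κ₀ : ℕ} (hκ : 6 ≤ κ₀) (hsmall : Real.sqrt 2 ^ (κ₀ - 6) * (2 * w.γ ^ 4 / E.b + w.γ ^ 6) < 1)
    (hnodes : ∀ P, Nodes (leaves w P)) (hgen : ForwardGenerated w.C.toB12 β) (hhalt : HaltsOutside w.C.toB12 β)
    (hcur : CurriesHBeta w.C.toB12 β) :
    (B16.Sect2Unconditional w.C ∧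
      ∃ Em Ep : ℝ, ∀ m : ℕ, ∃ gstar : ℝ, 0 < gstar ∧ ∀ g : ℝ, 0 < g → g ≤ gstar →
        ∀ K : ℕ, ∃ g0 : ℝ, (w.C ⟨K, m, g0⟩).flow.g K = g ∧
          ∀ k, k ≤ K → ∀ V : (w.C ⟨K, m, g0⟩).Cfg k, B16.UVIneq (w.C ⟨K, m, g0⟩) k V Em Ep) ∧
    ∀ P : B12.RunParams, (w.C.toB12 P).flow.InInterval w.γ P.K →
      B14FlowStep.SumIneq246 (w.C.toB12 P).flow.g κ₀ P.K :=
  p355Unconditional_and_sum246_of_eventualLower w hγw le_rfl (E.β'_pos.le.trans hβup) hnodes hgen hhalt hcur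
    (fun k => (E.cont k).mono fun _ hv => LimitForm.box_mono hγ₀ hv)
    (fun k v hv => (E.upper k v (LimitForm.box_mono hγ₀ hv)).trans hβup)
    (fun k v hv => (neg_le_neg hβup).trans (E.lower k v (LimitForm.box_mono hγ₀ hv))) E.b_pos
    (fun k hk v hv => E.tail k hk v (LimitForm.box_mono hγ₀ hv)) hMγ hBγ' hκ hsmall

/-- **The lower half of (0.31) on FINE lattices needs no small-k sign** (`FlowStepRuns.thm2_fineLattices_of_eventualLower`):
for `γ ≤ γ₀`, `0 < g` with `1/γ² + β′k₀ ≤ 1/g²` and every `K` with `(3b + 2β′)k₀ ≤ bK`, a bare coupling whose run stays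
in ]0,γ], ends at `g_K = g` and satisfies the discrete (0.31) with `b/2`. [cite: Balaban1987RG1, Thm 2 (0.31) p.259] -/
theorem thm2_fineLattices {C : B12.Construction} (hgen : ForwardGenerated C β) :
    ∀ (m : ℕ) (γ : ℝ), 0 < γ → γ ≤ E.γ₀ → ∀ g : ℝ, 0 < g → 1 / γ ^ 2 + E.β' * E.k₀ ≤ 1 / g ^ 2 →
      ∀ K : ℕ, (3 * E.b + 2 * E.β') * E.k₀ ≤ E.b * K →
        ∃ g0 : ℝ, (C ⟨K, m, g0⟩).flow.InInterval γ K ∧ (C ⟨K, m, g0⟩).flow.g K = g ∧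
          Step.Discrete031 (E.b / 2) E.β' K g (C ⟨K, m, g0⟩).flow.g :=
  thm2_fineLattices_of_eventualLower hgen E.b_pos E.β'_pos.le E.cont E.tail E.lower E.upper

/-- (AF-0) on ALL boxes from the finite β-level list `b ≤ β_{k+1}` on ]0,γ₀]^{k+1}, `k < k₀`. [folklore] -/
theorem betaLowerH_of_list (hsmall : ∀ k, k < E.k₀ → ∀ v ∈ Box E.γ₀ k, E.b ≤ β k v) : BetaLowerH E.b E.γ₀ β :=
  fun k v hv => (lt_or_ge k E.k₀).elim (fun hk => hsmall k hk v hv) (fun hk => E.tail k hk v hv)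

/-- **Theorem 2 AS PRINTED from the minimal form + the finite β-level list** — the one place the small-k signs are
consumed (`FlowStepRuns.thm2Printed_of_boxBoundsH`). [cite: Balaban1987RG1, Thm 2 p.259 with (0.31)] -/
theorem thm2Printed_of_list {C : B12.Construction} (hgen : ForwardGenerated C β) {L : ℝ} (hL : 1 < L)
    (hsmall : ∀ k, k < E.k₀ → ∀ v ∈ Box E.γ₀ k, E.b ≤ β k v) : B12.Thm2Printed C L :=
  thm2Printed_of_boxBoundsH hgen hL E.γ₀_pos E.b_pos E.b_le_β' E.cont (E.betaLowerH_of_list hsmall) E.upper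

end EventualForm

/-! ### 2′ The (MB) slot: BOUNDED OSCILLATION of the accumulated one-loop coefficients (rows an1 / an3)

The lead's ruling (BETA-SPEC v1.5 §6.1): for the END-STATEMENT grade the β-input may equally be (MB)
`|Σ_{j<k} β⁰_{j+1} − k·B| ≤ R` with `B > 0` (row an3's `Beta.Transfer.MarginalBounded` = row an1's `Beta.Drift.OneLoopDrift`),
together with (AF-1), (C) and the printed upper bound.  Its [I]-side consumers are LANDED in `Beta.Transfer` /`Beta.Drift`;
its [III]-side run-level consumer is `B14FlowStep.flowControl_of_driftSplit` (unit strat-b14).  The limit form implies it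
(`LimitForm.toBounded`, `R = c₀/(1−θ)`); it does NOT give the literal (0.31) nor an eventual pointwise sign. -/

/-- **The (MB) residual hypotheses**: a split `S`; box size `γ₀ > 0`; (MB) slope `B > 0` and oscillation bound `R ≥ 0` with
`Beta.Transfer.MarginalBounded S.β0 B R` (OPEN for (1.22) — row an3's (U2b⁻)/(U2d⁻), GAPS G-beta-an3-3, or row an1's drift);
(AF-1) with constant `C ≥ 0` (OPEN, row an4); (C) (OPEN, row an4); (U) printed.  Hypothesis carrier; nothing asserted.
[cite: Balaban1987RG1, (1.22) p.264 and Thm 2 p.259] -/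
structure BoundedForm (β : HBeta) where
  S : B12Beta.OneLoopSplit β
  γ₀ : ℝ
  γ₀_pos : 0 < γ₀
  /-- (MB): slope and oscillation bound of the accumulated one-loop coefficients — OPEN for (1.22). -/
  B : ℝ
  B_pos : 0 < B
  R : ℝ
  R_nonneg : 0 ≤ R
  osc : Transfer.MarginalBounded S.β0 B R
  /-- (AF-1) — OPEN (row an4). -/
  Cr : ℝ
  Cr_nonneg : 0 ≤ Cr
  af1 : ∀ k (p : Fin (k + 1) → ℝ), p ∈ B12Beta.HistBox γ₀ k → |S.β1 k p| ≤ Cr * p (Fin.last k)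
  /-- (C) — OPEN (row an4). -/
  cont : BetaContH γ₀ β
  /-- (U) — PRINTED ((5.10)+(5.42)). -/
  β' : ℝ
  β'_nonneg : 0 ≤ β'
  upper : BetaUpperH β' γ₀ β

namespace BoundedForm

variable {β : HBeta} (M : BoundedForm β)

/-- The explicit box size `γ₁ = min γ₀ (B/(C+1))` on which `Cγ₁ ≤ B`. [folklore] -/
def γ₁ : ℝ := min M.γ₀ (M.B / (M.Cr + 1))

/-- `0 < γ₁`. [folklore] -/
theorem γ₁_pos : 0 < M.γ₁ := lt_min M.γ₀_pos (div_pos M.B_pos (by linarith [M.Cr_nonneg]))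

/-- `γ₁ ≤ γ₀`. [folklore] -/
theorem γ₁_le : M.γ₁ ≤ M.γ₀ := min_le_left _ _

/-- `Cγ₁ ≤ B`. [folklore] -/
theorem Cr_mul_γ₁_le : M.Cr * M.γ₁ ≤ M.B := by
  have h1 : M.γ₁ ≤ M.B / (M.Cr + 1) := min_le_right _ _
  have hC1 : 0 < M.Cr + 1 := by linarith [M.Cr_nonneg]
  have h2 : M.Cr * M.γ₁ ≤ (M.Cr + 1) * M.γ₁ := by nlinarith [M.γ₁_pos.le]
  have h3 : (M.Cr + 1) * (M.B / (M.Cr + 1)) = M.B := by field_simp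
  nlinarith [h1, hC1.le]

/-- The same hypothesis in row an1's drift vocabulary. [folklore] -/
theorem drift : Drift.OneLoopDrift M.B M.R M.S.β0 := fun k => by
  simpa [Transfer.accum, mul_comm] using M.osc k

/-- (A-ps) with `M = 2R` on the box ]0,γ₁] (`Beta.Transfer.betaPartialSumsLowerH_of_marginalBounded`). [folklore] -/
theorem partialSums : BetaPartialSumsLowerH (2 * M.R) M.γ₁ β :=
  Transfer.betaPartialSumsLowerH_of_marginalBounded M.S M.osc
    (fun k p hp => M.af1 k p fun i => ⟨(hp i).1, (hp i).2.trans M.γ₁_le⟩) M.Cr_nonneg M.Cr_mul_γ₁_le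

/-- **Endpoint existence from the (MB) form** (`Beta.Transfer.endpointExistence_of_marginalBounded`, box ]0,γ₁]); no rate,
no sign of any single `β⁰_{k+1}`. [cite: Balaban1987RG1, Thm 2 p.259 (first sentence)] -/
theorem endpointExistence (M : BoundedForm β) {C : B12.Construction} (hgen : ForwardGenerated C β) :
    EndpointExistence C :=
  Transfer.endpointExistence_of_marginalBounded hgen M.S M.γ₁_pos M.R_nonneg M.osc
    (fun k p hp => M.af1 k p fun i => ⟨(hp i).1, (hp i).2.trans M.γ₁_le⟩) M.Cr_nonneg M.Cr_mul_γ₁_le M.β'_nonneg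
    (fun k => (M.cont k).mono fun _ hv => LimitForm.box_mono M.γ₁_le hv)
    (fun k v hv => M.upper k v (LimitForm.box_mono M.γ₁_le hv))

/-- **The p. 355 unconditional reading from the (MB) form** (`Beta.Transfer.p355Unconditional_of_marginalBounded`), the
world's interval small: `γ ≤ γ₀`, `Cγ ≤ B`, `β′ ≤ β⁺`, `2Rγ² ≤ β₀(2+β₀)`. [cite: Balaban1989LargeFieldII, p.355] -/
theorem p355 (w : World) (hγw : 0 < w.γ) (hγ₀ : w.γ ≤ M.γ₀) (hCrγ : M.Cr * w.γ ≤ M.B) (hβup : M.β' ≤ w.βup)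
    (hMγ : 2 * M.R * w.γ ^ 2 ≤ w.β₀ * (2 + w.β₀)) (hnodes : ∀ P, Nodes (leaves w P))
    (hgen : ForwardGenerated w.C.toB12 β) (hhalt : HaltsOutside w.C.toB12 β) (hcur : CurriesHBeta w.C.toB12 β) :
    B16.Sect2Unconditional w.C ∧
      ∃ Em Ep : ℝ, ∀ m : ℕ, ∃ gstar : ℝ, 0 < gstar ∧ ∀ g : ℝ, 0 < g → g ≤ gstar →
        ∀ K : ℕ, ∃ g0 : ℝ, (w.C ⟨K, m, g0⟩).flow.g K = g ∧
          ∀ k, k ≤ K → ∀ V : (w.C ⟨K, m, g0⟩).Cfg k, B16.UVIneq (w.C ⟨K, m, g0⟩) k V Em Ep :=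
  Transfer.p355Unconditional_of_marginalBounded w hγw le_rfl (M.β'_nonneg.trans hβup) hnodes hgen hhalt hcur
    (fun k => (M.cont k).mono fun _ hv => LimitForm.box_mono hγ₀ hv)
    (fun k v hv => (M.upper k v (LimitForm.box_mono hγ₀ hv)).trans hβup) M.S M.R_nonneg M.osc
    (fun k p hp => M.af1 k p fun i => ⟨(hp i).1, (hp i).2.trans hγ₀⟩) M.Cr_nonneg hCrγ hMγ

end BoundedForm

/-- **The limit form is a route to the (MB) form**: `B = β⁰_∞`, `R = c₀/(1−θ)`. [folklore] -/
def LimitForm.toBounded {β : HBeta} (D : LimitForm β) : BoundedForm β where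
  S := D.S
  γ₀ := D.γ₀
  γ₀_pos := D.γ₀_pos
  B := D.binf
  B_pos := D.binf_pos
  R := D.M
  R_nonneg := D.M_nonneg
  osc := D.marginalBounded
  Cr := D.Cr
  Cr_nonneg := D.Cr_nonneg
  af1 := D.af1
  cont := D.cont
  β' := D.β'
  β'_nonneg := D.β'_pos.le
  upper := D.upper

/-- **The limit form is a route to the minimal form**: `b = β⁰_∞/2`, the least `k₀`, the box ]0,γ₁], and the two-sided
constant `max β′ c₀` (the lower half from `β_{k+1} ≥ −c₀θ^k`). [folklore] -/
def LimitForm.toEventual {β : HBeta} (D : LimitForm β) : EventualForm β where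
  γ₀ := D.γ₁
  γ₀_pos := D.γ₁_pos
  b := D.binf / 2
  b_pos := half_pos D.binf_pos
  k₀ := D.k₀
  tail := D.tail_lower
  β' := max D.β' D.c₀
  upper := fun k v hv => (D.upper_mono D.γ₁_le k v hv).trans (le_max_left _ _)
  lower := fun k v hv =>
    (neg_le_neg (le_max_right D.β' D.c₀)).trans (D.lower_const D.γ₁_le D.Cr_mul_γ₁_le_binf k v hv)
  cont := D.cont_mono D.γ₁_le

/-! ## 3. Constructors: the fields of `LimitForm` from the rows' typed outputs -/

/-- **`LimitForm` from the rows' outputs.**  Given the split `S` (row BETA-0's dictionary identifies `S.β0` with the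
second moments of the one-loop kernels), the numbers of (AF-0∞)+(AF-0r) with the rate `hconv` (rows an1/an2/an3; in
kernel form `Beta.LimitRate`), row an4's clauses — `BetaDerivClause.LastVarLipschitzAtZero β C γ₀` (⇒ (AF-1) by the
printed vanishing (2.14), `BetaDerivClause.af1_of_atZero`) and `CoordLipschitzAt β k C_k γ₀` at every scale (⇒ (C),
`betaContH_of_coordLipschitz`) — and the printed upper bound. [cite: Balaban1987RG1, (2.14) p.268 and §1 p.264] -/
def LimitForm.ofClauses {β : HBeta} (S : B12Beta.OneLoopSplit β) {γ₀ binf c₀ θ Cr β' : ℝ} (hγ₀ : 0 < γ₀)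
    (hbinf : 0 < binf) (hc₀ : 0 ≤ c₀) (hθ0 : 0 ≤ θ) (hθ1 : θ < 1) (hconv : ∀ k, |S.β0 k - binf| ≤ c₀ * θ ^ k)
    (hCr : 0 ≤ Cr) (hAZ : BetaDerivClause.LastVarLipschitzAtZero β Cr γ₀)
    (hcoord : ∀ k, ∃ C : ℝ, 0 ≤ C ∧ BetaDerivClause.CoordLipschitzAt β k C γ₀) (hup : BetaUpperH β' γ₀ β) :
    LimitForm β where
  S := S
  γ₀ := γ₀
  γ₀_pos := hγ₀
  binf := binf
  binf_pos := hbinf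
  c₀ := c₀
  c₀_nonneg := hc₀
  θ := θ
  θ_nonneg := hθ0
  θ_lt_one := hθ1
  conv := hconv
  Cr := Cr
  Cr_nonneg := hCr
  af1 := BetaDerivClause.af1_of_atZero S hAZ
  cont := BetaDerivClause.betaContH_of_coordLipschitz hcoord
  β' := β'
  upper := hup

/-- **(U) discharged from print**: if each `β_{k+1}(v)` is the (1.22)/(5.42) second moment of a kernel obeying the
(5.10) decay `|Π(x)| ≤ C e^{−δ₁|x|}` uniformly on the box, then `β ≤ β′(d, C, δ₁)` there
(`FlowStepRuns.betaBoundsH_of_decay510`; the derivation of (5.10) itself is cell GAPS G-B12s-15).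
[cite: Balaban1987RG1, (5.10) p.293 and (5.42) p.297] -/
theorem upper_of_decay510 {d : ℕ} (μ ν : Fin d) (PfamH : (k : ℕ) → (Fin (k + 1) → ℝ) → B12Beta.Kernel d)
    (β : HBeta) {γ Cst δ₁ : ℝ} (hδ : 0 < δ₁) (hβ : ∀ k v, β k v = B12Beta.secondMoment (PfamH k v) μ ν)
    (hdec : ∀ k v, v ∈ Box γ k → B12Sec2to5.Decay510 (PfamH k v μ ν) Cst δ₁) :
    BetaUpperH (B12Sec2to5.betaPrime510 d Cst δ₁) γ β :=
  (betaBoundsH_of_decay510 μ ν PfamH β hδ hβ hdec).1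

/-- The (AF-0r) field read through row BETA-0's dictionary: if `S.β0 k` is the `μν` second moment of the one-loop limit
kernel at scale k (`Beta.OneLoopDictionary.beta0_eq`, (1.22)) then a rate on the second moments IS the field `conv`.
[cite: Balaban1987RG1, (1.22) p.264] -/
theorem conv_of_dictionary {d c : ℕ} {β : HBeta} {S : B12Beta.OneLoopSplit β} (Dct : OneLoopDictionary d c S)
    {μ ν : Fin d} (hμν : μ ≠ ν) {binf c₀ θ : ℝ}
    (hrate : ∀ k, |B12Beta.secondMoment (Dct.limKernel k) μ ν - binf| ≤ c₀ * θ ^ k) :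
    ∀ k, |S.β0 k - binf| ≤ c₀ * θ ^ k := fun k => by
  rw [Dct.beta0_eq k μ ν hμν]; exact hrate k

/-- **`LimitForm` over row BETA-0's dictionary from unit pv05-g3's KERNEL INPUTS** (`Beta.LimitRate.KernelInputs`:
k-uniform (5.10)-decay of the one-loop kernels `Π⁰_{k+1}` at zero coupling and propagator-convergence to a limit kernel
`Π⁰_∞` at a geometric rate — (PR), NOT PRINTED, rows an1/an2), a SIGN `0 < β⁰_∞` (rows an2/an3), row an4's clauses and
the printed upper bound: (AF-0r) is then `Beta.LimitRate.limitSplit_of_kernelInputs`, with `β⁰_∞ = K.binf`,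
`c₀ = K.c₀ = β′(C′,δ′)`, `θ = K.θ`. [cite: Balaban1987RG1, (1.22) p.264 and (5.10) p.293] -/
def LimitForm.ofKernelInputs {d c : ℕ} {β : HBeta} {S : B12Beta.OneLoopSplit β} (Dct : OneLoopDictionary d c S)
    (K : LimitRate.KernelInputs d Dct.limKernel) (hpos : 0 < K.binf) {γ₀ Cr β' : ℝ} (hγ₀ : 0 < γ₀) (hCr : 0 ≤ Cr)
    (hAZ : BetaDerivClause.LastVarLipschitzAtZero β Cr γ₀)
    (hcoord : ∀ k, ∃ C : ℝ, 0 ≤ C ∧ BetaDerivClause.CoordLipschitzAt β k C γ₀) (hup : BetaUpperH β' γ₀ β) :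
    LimitForm β :=
  LimitForm.ofClauses S hγ₀ hpos K.c₀_nonneg K.θ_nonneg K.θ_lt_one (LimitRate.limitSplit_of_kernelInputs Dct K)
    hCr hAZ hcoord hup

/-- Its constants are the kernel inputs' (`β⁰_∞ = K.binf`, `c₀ = K.c₀`, `θ = K.θ`) — by construction. [folklore] -/
theorem LimitForm.ofKernelInputs_consts {d c : ℕ} {β : HBeta} {S : B12Beta.OneLoopSplit β}
    (Dct : OneLoopDictionary d c S) (K : LimitRate.KernelInputs d Dct.limKernel) (hpos : 0 < K.binf)
    {γ₀ Cr β' : ℝ} (hγ₀ : 0 < γ₀) (hCr : 0 ≤ Cr) (hAZ : BetaDerivClause.LastVarLipschitzAtZero β Cr γ₀)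
    (hcoord : ∀ k, ∃ C : ℝ, 0 ≤ C ∧ BetaDerivClause.CoordLipschitzAt β k C γ₀) (hup : BetaUpperH β' γ₀ β) :
    (LimitForm.ofKernelInputs Dct K hpos hγ₀ hCr hAZ hcoord hup).binf = K.binf ∧
      (LimitForm.ofKernelInputs Dct K hpos hγ₀ hCr hAZ hcoord hup).c₀ = K.c₀ ∧
      (LimitForm.ofKernelInputs Dct K hpos hγ₀ hCr hAZ hcoord hup).θ = K.θ :=
  ⟨rfl, rfl, rfl⟩

/-- **The TRANSFER road to the sign** (row an3): with `B12Normalization.TransferBal S.β0 N L` — the one-loop coefficients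
tend to `(11N²/12π²) log L` in Bałaban's units, a HYPOTHESIS SHAPE asserted of nothing (`Beta.Transfer`) — the kernel
inputs' limit IS that number and is positive for `N > 0`, `L > 1` (`Beta.LimitRate.binf_pos_of_transfer`): no separate
sign input.  SOURCES (v1.2 DOCFIX G-beta-10r): the coefficients `β⁰_{k+1}` are those of (1.22) p. 264; the VALUE
`(11N²/12π²) log L` is NOT printed in [Balaban1987RG1] — (0.18) p. 255 prints only the recursion
`1/g₁² = 1/g₀² + β₁(g₀)` — it is the tree constant `B12Normalization.stepBal N L`, CONTEXT transported from the standard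
one-loop coefficient [MontvayMunster1994, (5.66)/(5.79)] by the `2N` dictionary of `B12Normalization` (GAPS C-beta-5), and
it enters this module only inside the hypothesis `TransferBal`. [cite: Balaban1987RG1, (1.22) p.264] -/
def LimitForm.ofTransfer {d c : ℕ} {β : HBeta} {S : B12Beta.OneLoopSplit β} (Dct : OneLoopDictionary d c S)
    (K : LimitRate.KernelInputs d Dct.limKernel) {N L : ℝ} (hT : B12Normalization.TransferBal S.β0 N L) (hN : 0 < N)
    (hL : 1 < L) {γ₀ Cr β' : ℝ} (hγ₀ : 0 < γ₀) (hCr : 0 ≤ Cr) (hAZ : BetaDerivClause.LastVarLipschitzAtZero β Cr γ₀)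
    (hcoord : ∀ k, ∃ C : ℝ, 0 ≤ C ∧ BetaDerivClause.CoordLipschitzAt β k C γ₀) (hup : BetaUpperH β' γ₀ β) :
    LimitForm β :=
  LimitForm.ofKernelInputs Dct K (LimitRate.binf_pos_of_transfer Dct K hT hN hL) hγ₀ hCr hAZ hcoord hup

/-- On the transfer road `β⁰_∞ = stepBal N L = (11N²/12π²) log L` (`Beta.LimitRate.binf_eq_stepBal_of_transfer`).
[cite: Balaban1987RG1, (1.22) p.264] -/
theorem LimitForm.ofTransfer_binf {d c : ℕ} {β : HBeta} {S : B12Beta.OneLoopSplit β} (Dct : OneLoopDictionary d c S)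
    (K : LimitRate.KernelInputs d Dct.limKernel) {N L : ℝ} (hT : B12Normalization.TransferBal S.β0 N L) (hN : 0 < N)
    (hL : 1 < L) {γ₀ Cr β' : ℝ} (hγ₀ : 0 < γ₀) (hCr : 0 ≤ Cr) (hAZ : BetaDerivClause.LastVarLipschitzAtZero β Cr γ₀)
    (hcoord : ∀ k, ∃ C : ℝ, 0 ≤ C ∧ BetaDerivClause.CoordLipschitzAt β k C γ₀) (hup : BetaUpperH β' γ₀ β) :
    (LimitForm.ofTransfer Dct K hT hN hL hγ₀ hCr hAZ hcoord hup).binf = B12Normalization.stepBal N L :=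
  LimitRate.binf_eq_stepBal_of_transfer Dct K hT

/-! ## 4. THE TYPED WALL: every hypothesis named, straight to the consumers

The census of row BETA-an5 as kernel theorems.  Hypotheses, by owner: `Dct : Beta.OneLoopDictionary d c S` (row BETA-0,
MODELLING: the identification of `β⁰_{k+1}` with (1.22) of the one-loop torus kernels' infinite-volume limit);
`K : Beta.LimitRate.KernelInputs d Dct.limKernel` (rows an1/an2: (UD) = (5.10) at zero coupling uniformly in k, a printed
CLAIM whose derivation is GAPS G-B12s-15; (PR) propagator-convergence with a rate — NOT PRINTED, OPEN); the SIGN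
`0 < K.binf` (row an2 direct — OPEN) or the transfer statement `TransferBal S.β0 N L` (row an3 — OPEN); `hAZ` =
`LastVarLipschitzAtZero β C γ₀` ((AF-1), row an4 — OPEN, located at [B13] (1.18-∂)/(P1)); `hcoord` = `CoordLipschitzAt`
at every scale ((C), row an4 — OPEN); `hup` (PRINTED, (5.10)+(5.42)); the construction clauses `ForwardGenerated` /
`HaltsOutside` / `CurriesHBeta` (MODELLING, non-vacuous by `FlowStepRuns` §6); and — ONLY for Theorem 2 with the
literal (0.31) — the finite list (AF-0s) (row num).  Nothing of the series is asserted. -/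

/-- **THE WALL ⇒ endpoint existence** (no small-k signs). [cite: Balaban1987RG1, Thm 2 p.259 (first sentence)] -/
theorem endpointExistence_of_wall {d c : ℕ} {β : HBeta} {S : B12Beta.OneLoopSplit β} (Dct : OneLoopDictionary d c S)
    (K : LimitRate.KernelInputs d Dct.limKernel) (hpos : 0 < K.binf) {γ₀ Cr β' : ℝ} (hγ₀ : 0 < γ₀) (hCr : 0 ≤ Cr)
    (hAZ : BetaDerivClause.LastVarLipschitzAtZero β Cr γ₀)
    (hcoord : ∀ k, ∃ C : ℝ, 0 ≤ C ∧ BetaDerivClause.CoordLipschitzAt β k C γ₀) (hup : BetaUpperH β' γ₀ β)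
    {C : B12.Construction} (hgen : ForwardGenerated C β) : EndpointExistence C :=
  (LimitForm.ofKernelInputs Dct K hpos hγ₀ hCr hAZ hcoord hup).endpointExistence hgen

/-- **THE WALL ⇒ Theorem 2 as printed**, with the finite list (AF-0s) of any length `k₁` past the threshold
`K.c₀·K.θ^{k₁} ≤ K.binf/4` — the numerics row's certified task once `c₀, θ, β⁰_∞` are numbers.
[cite: Balaban1987RG1, Thm 2 p.259 with (0.31)] -/
theorem thm2Printed_of_wall {d c : ℕ} {β : HBeta} {S : B12Beta.OneLoopSplit β} (Dct : OneLoopDictionary d c S)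
    (K : LimitRate.KernelInputs d Dct.limKernel) (hpos : 0 < K.binf) {γ₀ Cr β' : ℝ} (hγ₀ : 0 < γ₀) (hCr : 0 ≤ Cr)
    (hAZ : BetaDerivClause.LastVarLipschitzAtZero β Cr γ₀)
    (hcoord : ∀ k, ∃ C : ℝ, 0 ≤ C ∧ BetaDerivClause.CoordLipschitzAt β k C γ₀) (hup : BetaUpperH β' γ₀ β)
    {C : B12.Construction} (hgen : ForwardGenerated C β) {L : ℝ} (hL : 1 < L) {k₁ : ℕ}
    (hk₁ : K.c₀ * K.θ ^ k₁ ≤ K.binf / 4) (hsmall : ∀ k, k < k₁ → 3 * K.binf / 4 ≤ S.β0 k) :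
    B12.Thm2Printed C L :=
  (LimitForm.ofKernelInputs Dct K hpos hγ₀ hCr hAZ hcoord hup).thm2Printed_of_list hgen hL hk₁ hsmall

/-- **THE WALL on the transfer road ⇒ Theorem 2 as printed**: the sign comes from `TransferBal` (row an3), the list
(AF-0s) is measured against `(11N²/12π²) log L`. [cite: Balaban1987RG1, Thm 2 p.259 with (0.31)] -/
theorem thm2Printed_of_wall_transfer {d c : ℕ} {β : HBeta} {S : B12Beta.OneLoopSplit β}
    (Dct : OneLoopDictionary d c S) (K : LimitRate.KernelInputs d Dct.limKernel) {N L₀ : ℝ}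
    (hT : B12Normalization.TransferBal S.β0 N L₀) (hN : 0 < N) (hL₀ : 1 < L₀) {γ₀ Cr β' : ℝ} (hγ₀ : 0 < γ₀)
    (hCr : 0 ≤ Cr) (hAZ : BetaDerivClause.LastVarLipschitzAtZero β Cr γ₀)
    (hcoord : ∀ k, ∃ C : ℝ, 0 ≤ C ∧ BetaDerivClause.CoordLipschitzAt β k C γ₀) (hup : BetaUpperH β' γ₀ β)
    {C : B12.Construction} (hgen : ForwardGenerated C β) {L : ℝ} (hL : 1 < L) {k₁ : ℕ}
    (hk₁ : K.c₀ * K.θ ^ k₁ ≤ B12Normalization.stepBal N L₀ / 4)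
    (hsmall : ∀ k, k < k₁ → 3 * B12Normalization.stepBal N L₀ / 4 ≤ S.β0 k) : B12.Thm2Printed C L := by
  have hb : K.binf = B12Normalization.stepBal N L₀ := LimitRate.binf_eq_stepBal_of_transfer Dct K hT
  refine (LimitForm.ofTransfer Dct K hT hN hL₀ hγ₀ hCr hAZ hcoord hup).thm2Printed_of_list hgen hL (k₁ := k₁) ?_ ?_
  · show K.c₀ * K.θ ^ k₁ ≤ K.binf / 4
    rw [hb]; exact hk₁
  · intro k hk
    show 3 * K.binf / 4 ≤ S.β0 k
    rw [hb]; exact hsmall k hk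

/-! ## 5. Non-vacuity: the hypotheses of `LimitForm` / `EventualForm` are jointly satisfiable -/

namespace Witness

/-- The constant family `β_{k+1} ≡ 1`. [folklore] -/
def constOne : HBeta := fun _ _ => 1

/-- Its (trivial) one-loop split: `β⁰ ≡ 1`, `β¹ ≡ 0`. [folklore] -/
def splitOne : B12Beta.OneLoopSplit constOne where
  β0 := fun _ => 1
  β1 := fun _ _ => 0
  split := fun _ _ => by simp [constOne]
  vanish := fun _ _ _ => rfl

/-- A `LimitForm` for the constant family (`β⁰_∞ = 1`, `c₀ = 0`, `θ = 0`, `C = 0`, `β′ = 1`): the carrier is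
non-vacuous and `k₀ = 0`. [folklore] -/
def limitFormOne : LimitForm constOne where
  S := splitOne
  γ₀ := 1
  γ₀_pos := one_pos
  binf := 1
  binf_pos := one_pos
  c₀ := 0
  c₀_nonneg := le_rfl
  θ := 0
  θ_nonneg := le_rfl
  θ_lt_one := one_pos
  conv := fun k => by simp [splitOne]
  Cr := 0
  Cr_nonneg := le_rfl
  af1 := fun k p _ => by simp [splitOne]
  cont := fun k => continuousOn_const
  β' := 1
  upper := fun k v _ => le_rfl

/-- Non-vacuity of `LimitForm`. [folklore] -/
theorem limitForm_nonvacuous : Nonempty (LimitForm constOne) := ⟨limitFormOne⟩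

/-- … with the empty finite list. [folklore] -/
theorem limitFormOne_k₀ : limitFormOne.k₀ = 0 := limitFormOne.k₀_eq_zero rfl

/-- Non-vacuity of `EventualForm` (through `LimitForm.toEventual`). [folklore] -/
theorem eventualForm_nonvacuous : Nonempty (EventualForm constOne) := ⟨limitFormOne.toEventual⟩

/-- Non-vacuity of `BoundedForm` (through `LimitForm.toBounded`). [folklore] -/
theorem boundedForm_nonvacuous : Nonempty (BoundedForm constOne) := ⟨limitFormOne.toBounded⟩

end Witness

/-! ## 6. (v1.1, append-only) The (AF-1w) slot: a ONE-SIDED CONSTANT remainder bound suffices for the minimal form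

Row an4's NOTE 2026-08-18T18:26:28Z (REMAINDER-BETA §4) and the lead's "tail modulus" reading (BETA-SPEC v1.5 §6.1): for
the END-STATEMENT grade the remainder `β¹_{k+1}` need not be Lipschitz in `g_k` with a k-uniform constant ((AF-1),
`LimitForm.af1`); an eventual ONE-SIDED CONSTANT bound `−r ≤ β¹_{k+1}` on ]0,γ₀]^{k+1} with `r` below a fixed fraction
of `β⁰_∞` is enough (`FlowStepRuns.betaLowerTail_of_split_oneSided`, unit strat-b14).  The constructors below feed
`EventualForm` — hence endpoint existence, the p. 355 reading, (2.46) along runs and (0.31) on fine lattices — from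
that weaker slot; NO Lipschitz constant, NO rate beyond locating `k₀`.  Nothing of v1 is modified. -/

/-- Eventual `3β⁰_∞/4 ≤ β⁰_{k+1}` from (AF-0∞)+(AF-0r) (pure real analysis: `c₀θ^k → 0`). [folklore] -/
theorem exists_beta0_eventual {β0 : ℕ → ℝ} {binf c₀ θ : ℝ} (hbinf : 0 < binf) (hc₀ : 0 ≤ c₀) (hθ0 : 0 ≤ θ)
    (hθ1 : θ < 1) (hconv : ∀ k, |β0 k - binf| ≤ c₀ * θ ^ k) : ∃ k₀ : ℕ, ∀ k, k₀ ≤ k → 3 * binf / 4 ≤ β0 k := by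
  obtain ⟨k₀, hk₀⟩ : ∃ k₀ : ℕ, c₀ * θ ^ k₀ ≤ binf / 4 := by
    rcases eq_or_lt_of_le hc₀ with h | h
    · exact ⟨0, by rw [← h]; linarith⟩
    · obtain ⟨n, hn⟩ := exists_pow_lt_of_lt_one (div_pos (by linarith : 0 < binf / 4) h) hθ1
      refine ⟨n, ?_⟩
      have := (lt_div_iff₀ h).mp hn
      linarith [mul_comm (θ ^ n) c₀]
  refine ⟨k₀, fun k hk => ?_⟩
  have hθk : c₀ * θ ^ k ≤ c₀ * θ ^ k₀ :=
    mul_le_mul_of_nonneg_left (pow_le_pow_of_le_one hθ0 hθ1.le hk) hc₀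
  have h := (abs_le.mp (hconv k)).1
  linarith

/-- **`EventualForm` from a split with an eventual one-loop bound `2b ≤ β⁰_{k+1}` and a ONE-SIDED CONSTANT remainder
bound `−b ≤ β¹_{k+1}` on ]0,γ₀]^{k+1} (both for `k ≥ k₀`), the printed two-sided bound and (C)** — row an4's weakened
(AF-1w) slot; no Lipschitz constant (`FlowStepRuns.betaLowerTail_of_split_oneSided`).
[cite: Balaban1987RG1, (2.12)–(2.14) p.268 and §1 p.264] -/
def EventualForm.ofSplitOneSided {β : HBeta} (S : B12Beta.OneLoopSplit β) {γ₀ b β' : ℝ} {k₀ : ℕ} (hγ₀ : 0 < γ₀)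
    (hb : 0 < b) (hAF0 : ∀ k, k₀ ≤ k → 2 * b ≤ S.β0 k) (hAF1w : ∀ k, k₀ ≤ k → ∀ v ∈ Box γ₀ k, -b ≤ S.β1 k v)
    (hup : BetaUpperH β' γ₀ β) (hlo : ∀ k, ∀ v ∈ Box γ₀ k, -β' ≤ β k v) (hcont : BetaContH γ₀ β) :
    EventualForm β where
  γ₀ := γ₀
  γ₀_pos := hγ₀
  b := b
  b_pos := hb
  k₀ := k₀
  tail := betaLowerTail_of_split_oneSided S hAF0 hAF1w
  β' := β'
  upper := hup
  lower := hlo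
  cont := hcont

/-- **`EventualForm` from (AF-0∞)+(AF-0r) and a one-sided CONSTANT remainder bound `−r ≤ β¹_{k+1}` on all
]0,γ₀]-boxes with `r ≤ 3β⁰_∞/8`** (+ the printed two-sided bound, (C)): `b = 3β⁰_∞/8`, `k₀` = a scale from which
`3β⁰_∞/4 ≤ β⁰_{k+1}` (`exists_beta0_eventual`, chosen classically).  The weakest β-input this module turns into the END
statement: one sign `0 < β⁰_∞`, one convergence `β⁰_{k+1} → β⁰_∞` (the rate only locates `k₀`), one constant.
[cite: Balaban1987RG1, (1.22) p.264] -/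
def EventualForm.ofConvConst {β : HBeta} (S : B12Beta.OneLoopSplit β) {γ₀ binf c₀ θ r β' : ℝ} (hγ₀ : 0 < γ₀)
    (hbinf : 0 < binf) (hc₀ : 0 ≤ c₀) (hθ0 : 0 ≤ θ) (hθ1 : θ < 1) (hconv : ∀ k, |S.β0 k - binf| ≤ c₀ * θ ^ k)
    (hrem : ∀ k, ∀ v ∈ Box γ₀ k, -r ≤ S.β1 k v) (hr : r ≤ 3 * binf / 8) (hup : BetaUpperH β' γ₀ β)
    (hlo : ∀ k, ∀ v ∈ Box γ₀ k, -β' ≤ β k v) (hcont : BetaContH γ₀ β) : EventualForm β :=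
  EventualForm.ofSplitOneSided S hγ₀ (b := 3 * binf / 8)
    (k₀ := Classical.choose (exists_beta0_eventual hbinf hc₀ hθ0 hθ1 hconv)) (by linarith)
    (fun k hk => by
      have h := Classical.choose_spec (exists_beta0_eventual hbinf hc₀ hθ0 hθ1 hconv) k hk
      linarith)
    (fun k _ v hv => by have h := hrem k v hv; linarith) hup hlo hcont

/-- Its lower constant is `3β⁰_∞/8` — by construction. [folklore] -/
theorem EventualForm.ofConvConst_b {β : HBeta} (S : B12Beta.OneLoopSplit β) {γ₀ binf c₀ θ r β' : ℝ} (hγ₀ : 0 < γ₀)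
    (hbinf : 0 < binf) (hc₀ : 0 ≤ c₀) (hθ0 : 0 ≤ θ) (hθ1 : θ < 1) (hconv : ∀ k, |S.β0 k - binf| ≤ c₀ * θ ^ k)
    (hrem : ∀ k, ∀ v ∈ Box γ₀ k, -r ≤ S.β1 k v) (hr : r ≤ 3 * binf / 8) (hup : BetaUpperH β' γ₀ β)
    (hlo : ∀ k, ∀ v ∈ Box γ₀ k, -β' ≤ β k v) (hcont : BetaContH γ₀ β) :
    (EventualForm.ofConvConst S hγ₀ hbinf hc₀ hθ0 hθ1 hconv hrem hr hup hlo hcont).b = 3 * binf / 8 := rfl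

/-- **THE WEAKEST WALL ⇒ endpoint existence**: (AF-0∞)+(AF-0r) [rows an1/an2/an3, pv05-g3] + (AF-1w) one-sided constant
remainder bound [row an4: printed chain modulo the named leaves] + (TS) printed + (C) [row an4] + forward generation
[modelling]. [cite: Balaban1987RG1, Thm 2 p.259 (first sentence)] -/
theorem endpointExistence_of_convConst {β : HBeta} (S : B12Beta.OneLoopSplit β) {γ₀ binf c₀ θ r β' : ℝ}
    (hγ₀ : 0 < γ₀) (hbinf : 0 < binf) (hc₀ : 0 ≤ c₀) (hθ0 : 0 ≤ θ) (hθ1 : θ < 1)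
    (hconv : ∀ k, |S.β0 k - binf| ≤ c₀ * θ ^ k) (hrem : ∀ k, ∀ v ∈ Box γ₀ k, -r ≤ S.β1 k v) (hr : r ≤ 3 * binf / 8)
    (hup : BetaUpperH β' γ₀ β) (hlo : ∀ k, ∀ v ∈ Box γ₀ k, -β' ≤ β k v) (hcont : BetaContH γ₀ β)
    {C : B12.Construction} (hgen : ForwardGenerated C β) : EndpointExistence C :=
  (EventualForm.ofConvConst S hγ₀ hbinf hc₀ hθ0 hθ1 hconv hrem hr hup hlo hcont).endpointExistence hgen

namespace Witness

/-- Non-vacuity of the (AF-1w) road: `β ≡ 1` (`β⁰ ≡ 1`, `β¹ ≡ 0`, `β⁰_∞ = 1`, `c₀ = θ = r = 0`). [folklore] -/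
theorem ofConvConst_nonvacuous : Nonempty (EventualForm constOne) :=
  ⟨EventualForm.ofConvConst splitOne (γ₀ := 1) (binf := 1) (c₀ := 0) (θ := 0) (r := 0) (β' := 1) one_pos one_pos
    le_rfl le_rfl one_pos (fun k => by simp [splitOne]) (fun k v _ => by simp [splitOne]) (by norm_num)
    (fun k v _ => le_rfl) (fun k v _ => by show (-1 : ℝ) ≤ 1; norm_num) (fun k => continuousOn_const)⟩

end Witness

end

end Literature.MathematicalPhysics.QuantumFieldTheory.Balaban1983to89.Beta.Assembly
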